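import Literature.Geometry.Riemannian.ThreeShrinkerHamiltonIveyChart
import Literature.Geometry.Riemannian.HamiltonIveyCutoff
import Literature.Geometry.Riemannian.RicciTopEigenvalue
import Literature.Geometry.Riemannian.ShrinkerScalarCurvatureNonnegHolds
import Literature.Geometry.Riemannian.ShrinkerPotentialGrowthProofs
import HarnessLib

/-!
# Complete three-dimensional gradient shrinking Ricci solitons have `sect ≥ 0` (B.-L. Chen 2009, Cor. 2.4)

**Theorem** (B.-L. Chen, *Strong uniqueness of the Ricci flow*, J. Differential Geom. 82 (2009),
Cor. 2.4, for shrinkers: "any complete three-dimensional ancient solution has nonnegative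
sectional curvature"; a complete gradient shrinker generates a complete ancient solution,
Z.-H. Zhang 2009). For a complete connected three-dimensional gradient shrinking Ricci soliton
`Ric + Hess f = ½ g`, normalised by `R + |∇f|² = f`:

* **`ThreeShrinker.two_mul_ricci_le_scalarCurvature`** — `2 Ric(w,w) ≤ R |w|²` for every tangent
  vector (every eigenvalue of `Ric` is `≤ R/2`, i.e. every sectional curvature
  `K_{ij} = R/2 − μ_k` is `≥ 0`, Lee 2018, Prop. 8.32);
* **`ThreeShrinker.ricci_nonneg`** — hence `Ric ≥ 0`
  (`MetricCoord.ricAt_nonneg_of_two_mul_le_scalAt`), the curvature input **(F1)** of the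
  classification of three-dimensional shrinkers (`ThreeShrinkerClassificationAssembly.lean`,
  hypothesis `hF1` of `ThreeShrinker.modelData_of_curvature_inputs`).

NO curvature assumption (boundedness, sign, growth) is made. The proof given here is new in
form: it is ELLIPTIC, a localised maximum principle in the style of Zhang's proof of `R ≥ 0`
(`ShrinkerScalarCurvatureNonnegHolds.lean`) for the Hamilton–Ivey quantity
`w = X e^{−R/X}`, `X = 2λ_max(Ric) − R = −2 sect_min` (Hamilton 1995, §24, Thm. 24.4; Ivey 1993),
which on a three-dimensional shrinker is a viscosity subsolution of `Δ_f w ≥ w(1 + X) ≥ w + w²`: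
with the cut-off `Θ_A(f)` of `HamiltonIvey.exists_cutoff_family` (supported in the compact
sub-level set `{f ≤ 2A}`, Haslhofer–Müller properness), the maximum point `p` of `Θ_A(f)·w`
satisfies `Θ(1 + X) ≤ K/A` (`HamiltonIvey.chart_step`: geodesic/parallel-frame second-order
conditions `CoordCutoffAffineMaximum`, Hamilton's identities `ShrinkerHamiltonIveyPoint`, the cubic
inequality `HamiltonIveyShrinkerAlgebra`), whence `w(x) ≤ max Θ_A(f) w ≤ K/A → 0` at any fixed
`x`: `w ≡ 0`, i.e. `X ≤ 0`. Everything is proved; no definition and no named fact is introduced.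

## References

* B.-L. Chen, *Strong uniqueness of the Ricci flow*, J. Differential Geom. 82 (2009) 363–382,
  Cor. 2.4. [Chen2009]
* R. S. Hamilton, *The formation of singularities in the Ricci flow*, Surveys in Differential
  Geometry II (1995), §24, Thm. 24.4. [Hamilton1995]
* T. Ivey, *Ricci solitons on compact three-manifolds*, Diff. Geom. Appl. 3 (1993). [Ivey1993]
* Z.-H. Zhang, *On the completeness of gradient Ricci solitons*, Proc. AMS 137 (2009), Thm. 1.3. [Zhang2009]
* R. Haslhofer, R. Müller, GAFA 21 (2011), Lemma 2.1. [HaslhoferMuller2011]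
* J. M. Lee, *Introduction to Riemannian Manifolds* (2018), Prop. 8.32. [Lee2018]
-/

noncomputable section

set_option maxSynthPendingDepth 3

open Set Filter Module Metric
open scoped Manifold ContDiff Topology NNReal ENNReal

namespace Literature.Geometry.Riemannian

open Lorentzian Lorentzian.PseudoRiemannianMetric

namespace ThreeShrinker

variable {N : Type} [TopologicalSpace N] [T2Space N] [SecondCountableTopology N]
  [ChartedSpace (EuclideanSpace ℝ (Fin 3)) N] [IsManifold (𝓡 3) ∞ N] [ConnectedSpace N]
  [T3Space N] [MeasurableSpace N] [BorelSpace N]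
  (h : PseudoRiemannianMetric (𝓡 3) ∞ (EuclideanSpace ℝ (Fin 3)) (TangentSpace (𝓡 3) : N → Type _))
  [h.HasLeviCivita] (φ : N → ℝ) (hh : h.IsRiemannian)

omit [SecondCountableTopology N] [T3Space N] [MeasurableSpace N] [BorelSpace N] in
/-- **The potential of a complete shrinker is proper** (Haslhofer–Müller 2011, Lemma 2.1): with
`R ≥ 0`, every sub-level set `{φ ≤ c}` is compact (closed, inside a closed ball about a minimum
point `p₀` of `φ` by the growth `¼(d(p₀,·) − 15)₊² ≤ φ`). [cite: HaslhoferMuller2011, Lemma 2.1 (p. 5)] -/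
theorem isCompact_potential_le
    (hcpl : ∀ (x : N) (r : ℝ≥0), IsCompact {y : N | h.edist hh x y ≤ r})
    (hφ : ContMDiff (𝓡 3) 𝓘(ℝ, ℝ) ∞ φ)
    (hsol : ∀ (x : N) (X Y : TangentSpace (𝓡 3) x),
      h.ricci x X Y + h.hessian φ x X Y = (1 / 2 : ℝ) * h.val x X Y)
    (hnorm : ∀ x : N, h.scalarCurvature x + h.gradSq φ x = φ x)
    (hR0 : ∀ x : N, 0 ≤ h.scalarCurvature x) (c : ℝ) : IsCompact {y : N | φ y ≤ c} := by
  have hk1 : ((1 : ℕ∞) : ℕ∞ω) + 1 ≤ (∞ : ℕ∞ω) := by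
    rw [show ((1 : ℕ∞) : ℕ∞ω) + 1 = 2 by norm_num]
    exact WithTop.coe_le_coe.2 le_top
  haveI : CovariantDerivative.ContMDiffCovariantDerivative h.leviCivita 1 :=
    ⟨h.isLocallyContMDiff_leviCivita_holds 1 hk1 univ isOpen_univ⟩
  haveI : CovariantDerivative.ContMDiffCovariantDerivative h.leviCivita ∞ :=
    ⟨h.isLocallyContMDiff_leviCivita_holds ⊤ (le_of_eq rfl) univ isOpen_univ⟩
  have hgrad : ∀ x, h.gradSq φ x ≤ φ x := fun x ↦ by linarith [hR0 x, hnorm x]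
  obtain ⟨p, hp⟩ := HaslhoferMuller.exists_forall_potential_le h hh hcpl hφ hgrad hsol
  have hlow : ∀ (x : N) (r : ℝ≥0), (r : ℝ≥0∞) ≤ h.edist hh p x →
      (1 / 4 : ℝ) * (max ((r : ℝ) - 5 * 3) 0) ^ 2 ≤ φ x := fun x r hr ↦ by
    have h1 := HaslhoferMuller.potential_lower_of_scalarCurvature_nonneg h hh hcpl hφ hsol hnorm
      hR0 hp x r hr
    rwa [finrank_euclideanSpace_fin, Nat.cast_ofNat] at h1
  -- closed and inside a compact ball
  have hv : 0 ≤ 5 * (3 : ℝ) + 2 * Real.sqrt (max c 0) + 1 := by positivity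
  set r₀ : ℝ≥0 := (5 * (3 : ℝ) + 2 * Real.sqrt (max c 0) + 1).toNNReal with hr₀
  refine (hcpl p r₀).of_isClosed_subset (isClosed_le hφ.continuous continuous_const) fun x hx ↦ ?_
  rw [mem_setOf_eq] at hx ⊢
  by_contra hlt
  have hle : (r₀ : ℝ≥0∞) ≤ h.edist hh p x := le_of_lt (not_le.1 hlt)
  have h1 := hlow x r₀ hle
  have hr : (r₀ : ℝ) - 5 * 3 = 2 * Real.sqrt (max c 0) + 1 := by
    rw [hr₀, Real.coe_toNNReal _ hv]; ring
  rw [hr, max_eq_left (by positivity)] at h1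
  have hs : Real.sqrt (max c 0) ^ 2 = max c 0 := Real.sq_sqrt (le_max_right c 0)
  have hc' : c ≤ max c 0 := le_max_left _ _
  nlinarith [Real.sqrt_nonneg (max c 0)]

/-- **Chen 2009, Cor. 2.4 (shrinkers): complete three-dimensional gradient shrinking solitons have
non-negative sectional curvature**, in the form `2 Ric(w,w) ≤ R |w|²` for every tangent vector `w`
of a complete connected normalised three-dimensional gradient shrinker (every eigenvalue of `Ric`
is at most `R/2`; in dimension three the sectional curvatures are `R/2 − μ_k`). Elliptic proof by
the localised maximum principle for the Hamilton–Ivey quantity `(2λ_max − R) e^{−R/(2λ_max − R)}`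
(module docstring). [cite: Chen2009, Cor. 2.4] [cite: Hamilton1995, §24, Thm. 24.4] -/
theorem two_mul_ricci_le_scalarCurvature
    (hcpl : ∀ (x : N) (r : ℝ≥0), IsCompact {y : N | h.edist hh x y ≤ r})
    (hφ : ContMDiff (𝓡 3) 𝓘(ℝ, ℝ) ∞ φ)
    (hsol : ∀ (x : N) (X Y : TangentSpace (𝓡 3) x),
      h.ricci x X Y + h.hessian φ x X Y = (1 / 2 : ℝ) * h.val x X Y)
    (hnorm : ∀ x : N, h.scalarCurvature x + h.gradSq φ x = φ x)
    (x : N) (w : TangentSpace (𝓡 3) x) :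
    2 * h.ricci x w w ≤ h.scalarCurvature x * h.val x w w := by
  classical
  have hR0 : ∀ y : N, 0 ≤ h.scalarCurvature y :=
    shrinkerScalarCurvature_nonneg_holds 3 N h φ hh hcpl hφ hsol hnorm
  have hk1 : ((1 : ℕ∞) : ℕ∞ω) + 1 ≤ (∞ : ℕ∞ω) := by
    rw [show ((1 : ℕ∞) : ℕ∞ω) + 1 = 2 by norm_num]
    exact WithTop.coe_le_coe.2 le_top
  haveI : CovariantDerivative.ContMDiffCovariantDerivative h.leviCivita 1 :=
    ⟨h.isLocallyContMDiff_leviCivita_holds 1 hk1 univ isOpen_univ⟩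
  haveI : CovariantDerivative.ContMDiffCovariantDerivative h.leviCivita ∞ :=
    ⟨h.isLocallyContMDiff_leviCivita_holds ⊤ (le_of_eq rfl) univ isOpen_univ⟩
  have hgrad : ∀ y, h.gradSq φ y ≤ φ y := fun y ↦ by linarith [hR0 y, hnorm y]
  have hK : ∀ c : ℝ, IsCompact {y : N | φ y ≤ c} :=
    isCompact_potential_le h φ hh hcpl hφ hsol hnorm hR0
  -- the top eigenvalue function `Λ` and its properties
  have h3 : finrank ℝ (EuclideanSpace ℝ (Fin 3)) = 3 := finrank_euclideanSpace_fin
  obtain ⟨hΛc, hΛ, hΛle⟩ := ricciSup_spec h hh (by rw [h3]; norm_num)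
  set Λ : N → ℝ := fun y ↦ sSup ((fun w : TangentSpace (𝓡 3) y ↦ h.ricci y w w / h.val y w w) ''
    {w | w ≠ 0}) with hΛdef
  -- the Hamilton–Ivey quantity `W = X e^{−R/X}` (`X = 2Λ − R > 0`), extended by `0`
  have hRc : Continuous h.scalarCurvature := (contMDiff_scalarCurvature h).continuous
  have hXc : Continuous fun y ↦ 2 * Λ y - h.scalarCurvature y :=
    (continuous_const.mul hΛc).sub hRc
  set W : N → ℝ := fun y ↦ if 0 < 2 * Λ y - h.scalarCurvature y then
    (2 * Λ y - h.scalarCurvature y) *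
      Real.exp (-h.scalarCurvature y / (2 * Λ y - h.scalarCurvature y)) else 0 with hWdef
  have hWc : Continuous W := HamiltonIvey.continuous_posPart_mul_exp hXc hRc hR0
  have hW0 : ∀ y, 0 ≤ W y := fun y ↦ by
    simp only [hWdef]
    split_ifs with hy
    · exact (mul_pos hy (Real.exp_pos _)).le
    · exact le_rfl
  -- suppose the claim fails at `(x, w)`
  by_contra hneg
  push Not at hneg
  have hw : w ≠ 0 := by
    rintro rfl
    simp at hneg
  have hvx : 0 < h.val x w w := hh x w hw
  have hXx : 0 < 2 * Λ x - h.scalarCurvature x := by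
    have h1 := hΛ x w
    nlinarith
  have hWx : 0 < W x := by
    simp only [hWdef, if_pos hXx]
    exact mul_pos hXx (Real.exp_pos _)
  -- the cut-off family
  obtain ⟨K, -, hfam⟩ := HamiltonIvey.exists_cutoff_family
  have hmain : ∀ A : ℝ, max (3 / 2) (φ x) ≤ A → W x ≤ K / A := by
    intro A hA
    have hA32 : 3 / 2 ≤ A := le_trans (le_max_left _ _) hA
    have hAx : φ x ≤ A := le_trans (le_max_right _ _) hA
    obtain ⟨Θ, Θ', Θ'', hΘ, hΘ', hΘ1, hΘ0, hΘ01, hE⟩ := hfam A hA32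
    have hΘc : Continuous Θ := continuous_iff_continuousAt.2 fun t ↦ (hΘ t).continuousAt
    set u : N → ℝ := fun y ↦ Θ (φ y) * W y with hudef
    have huc : Continuous u := (hΘc.comp hφ.continuous).mul hWc
    have hu0 : ∀ y, 0 ≤ u y := fun y ↦ mul_nonneg (hΘ01 _).1 (hW0 y)
    -- the maximum over the compact `{φ ≤ 2A}` is a global maximum
    have hxK : x ∈ {y : N | φ y ≤ 2 * A} := by
      rw [mem_setOf_eq]; linarith
    obtain ⟨p, -, hpmax⟩ := (hK (2 * A)).exists_isMaxOn ⟨x, hxK⟩ huc.continuousOn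
    have hglob : ∀ y, u y ≤ u p := fun y ↦ by
      by_cases hy : φ y ≤ 2 * A
      · exact hpmax hy
      · have : u y = 0 := by
          simp only [hudef, hΘ0 (φ y) (le_of_lt (not_le.1 hy)), zero_mul]
        rw [this]
        exact hu0 p
    have hux : u x = W x := by simp only [hudef, hΘ1 (φ x) hAx, one_mul]
    have hWxle : W x ≤ u p := hux ▸ hglob x
    have hup : 0 < u p := lt_of_lt_of_le hWx hWxle
    -- at `p`: `Θ(φ p) > 0`, `W p > 0`, `X p > 0`
    have hΘp : 0 < Θ (φ p) := by
      rcases (hΘ01 (φ p)).1.lt_or_eq with hlt | heq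
      · exact hlt
      · exfalso
        have : u p = 0 := by simp only [hudef, ← heq, zero_mul]
        linarith
    have hWp : 0 < W p := by
      rcases (hW0 p).lt_or_eq with hlt | heq
      · exact hlt
      · exfalso
        have : u p = 0 := by simp only [hudef, ← heq, mul_zero]
        linarith
    have hXp : 0 < 2 * Λ p - h.scalarCurvature p := by
      by_contra hle
      have : W p = 0 := by simp only [hWdef, if_neg hle]
      linarith
    have hWpeq : W p = (2 * Λ p - h.scalarCurvature p) *
        Real.exp (-h.scalarCurvature p / (2 * Λ p - h.scalarCurvature p)) := by
      simp only [hWdef, if_pos hXp]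
    -- the chart step at `p`
    have hbound : ∀ y : N, 0 < 2 * Λ y - h.scalarCurvature y →
        Θ (φ y) * ((2 * Λ y - h.scalarCurvature y) *
          Real.exp (-h.scalarCurvature y / (2 * Λ y - h.scalarCurvature y))) ≤ u p := by
      intro y hy
      have h1 := hglob y
      simp only [hudef, hWdef, if_pos hy] at h1 ⊢
      exact h1
    have hmaxeq : Θ (φ p) * ((2 * Λ p - h.scalarCurvature p) *
        Real.exp (-h.scalarCurvature p / (2 * Λ p - h.scalarCurvature p))) = u p := by
      rw [← hWpeq]
    have hcs := HamiltonIvey.chart_step h hh h3 hφ hsol hnorm hR0 Λ hΛ p (hΛle p) hΘ hΘ'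
      (fun t ↦ (hΘ01 t).1) hbound hXp hmaxeq hΘp
    have hEp := hE (φ p) (h.gradSq φ p) hΘp (h.gradSq_nonneg hh φ p) (hgrad p)
    -- `W x ≤ u p = Θ W(p) ≤ Θ X(p) ≤ Θ (1 + X(p)) ≤ K / A`
    have hWX : W p ≤ 2 * Λ p - h.scalarCurvature p := by
      rw [hWpeq]
      exact HamiltonIvey.mul_exp_le_self _ _ (hR0 p) hXp.le
    calc W x ≤ u p := hWxle
      _ = Θ (φ p) * W p := rfl
      _ ≤ Θ (φ p) * (1 + (2 * Λ p - h.scalarCurvature p)) :=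
          mul_le_mul_of_nonneg_left (by linarith) hΘp.le
      _ ≤ K / A := hcs.trans hEp
  -- `A → ∞`
  have hlim : Tendsto (fun A : ℝ ↦ K / A) atTop (𝓝 0) := tendsto_const_nhds.div_atTop tendsto_id
  have hle0 : W x ≤ 0 :=
    ge_of_tendsto hlim (eventually_atTop.2 ⟨max (3 / 2) (φ x), fun A hA ↦ hmain A hA⟩)
  exact absurd hle0 (not_le.2 hWx)

/-- **(F1) Complete three-dimensional gradient shrinking solitons have `Ric ≥ 0`** (B.-L. Chen
2009, Cor. 2.4: even `sect ≥ 0`), the curvature input `hF1` of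
`ThreeShrinker.modelData_of_curvature_inputs`: from `2 Ric ≤ R g`
(`two_mul_ricci_le_scalarCurvature`) read in a chart and
`MetricCoord.ricAt_nonneg_of_two_mul_le_scalAt`. [cite: Chen2009, Cor. 2.4] -/
theorem ricci_nonneg
    (hcpl : ∀ (x : N) (r : ℝ≥0), IsCompact {y : N | h.edist hh x y ≤ r})
    (hφ : ContMDiff (𝓡 3) 𝓘(ℝ, ℝ) ∞ φ)
    (hsol : ∀ (x : N) (X Y : TangentSpace (𝓡 3) x),
      h.ricci x X Y + h.hessian φ x X Y = (1 / 2 : ℝ) * h.val x X Y)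
    (hnorm : ∀ x : N, h.scalarCurvature x + h.gradSq φ x = φ x)
    (x : N) (w : TangentSpace (𝓡 3) x) : 0 ≤ h.ricci x w w := by
  have hsect := two_mul_ricci_le_scalarCurvature h φ hh hcpl hφ hsol hnorm
  have h3 : finrank ℝ (EuclideanSpace ℝ (Fin 3)) = 3 := finrank_euclideanSpace_fin
  -- chart at `x`
  set G := chartRep (𝓡 3) (fun _ ↦ h) x 0 with hGdef
  have hGm : MetricCoord.IsMetricOn G (extChartAt (𝓡 3) x).target :=
    Lorentzian.OpensChart.isMetricOn_repr (val_chartPullback_eq_chartRep (fun _ : ℝ ↦ h) x 0)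
  have hu₀ : extChartAt (𝓡 3) x x ∈ (extChartAt (𝓡 3) x).target := mem_extChartAt_target x
  set u₀ : chartTarget (𝓡 3) x := ⟨extChartAt (𝓡 3) x x, hu₀⟩ with hu₀def
  have hpu : chartInv (𝓡 3) x u₀ = x := extChartAt_to_inv x
  have hpos : ∀ v : EuclideanSpace ℝ (Fin 3), v ≠ 0 → 0 < G u₀ v v := fun v hv ↦ by
    rw [hGdef, chartRep_apply]
    exact chartPullback_pos h x u₀ (fun w' hw' ↦ hh _ w' hw') v hv
  -- the hypothesis of the coordinate lemma, read from the manifold statement at `Φ(u₀) = x`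
  have hle : ∀ v : EuclideanSpace ℝ (Fin 3), 2 * MetricCoord.ricAt G u₀ v v ≤
      MetricCoord.scalAt G u₀ * G u₀ v v := fun v ↦ by
    have h1 := hsect (chartInv (𝓡 3) x u₀)
      (mfderiv 𝓘(ℝ, EuclideanSpace ℝ (Fin 3)) (𝓡 3) (chartInv (𝓡 3) x) u₀ v)
    rwa [ricci_chartInv_mfderiv_eq_ricAt, val_chartInv_mfderiv_eq_chartRep,
      Lorentzian.scalarCurvature_chartInv_eq] at h1
  -- every `w ∈ T_x N` is `dΦ_{u₀} v`
  have hQ : (fun y : N ↦ ∀ w : TangentSpace (𝓡 3) y, 0 ≤ h.ricci y w w) (chartInv (𝓡 3) x u₀) := by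
    intro w'
    have hinj := injective_mfderiv_chartInv (I := 𝓡 3) x u₀
    have hinv := isInvertible_mfderiv_of_injective rfl hinj
    set L := mfderiv 𝓘(ℝ, EuclideanSpace ℝ (Fin 3)) (𝓡 3) (chartInv (𝓡 3) x) u₀ with hL
    obtain ⟨v, hv⟩ : ∃ v : EuclideanSpace ℝ (Fin 3), L v = w' :=
      ⟨L.inverse w', by rw [← ContinuousLinearMap.comp_apply, hinv.self_comp_inverse]; rfl⟩
    have h1 := MetricCoord.ricAt_nonneg_of_two_mul_le_scalAt hGm hu₀ h3 hpos hle v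
    have h2 := ricci_chartInv_mfderiv_eq_ricAt h x u₀ v v
    rw [← hv]
    exact h1.trans_eq h2.symm
  rw [hpu] at hQ
  exact hQ w

end ThreeShrinker

end Literature.Geometry.Riemannian

end
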